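import Summits.QuantumFields.YangMills.Theorems.UnitScaleTiltProp7LineAvgTwoBlock
import HarnessLib

/-!
# Route `UnitScaleTilt`, crux K1 child «MinimiserStabilityRegPr» (stmt-QuantumFields-19200), registered stub `stub_prop7From14` (skeleton birth_v5
# 98cb23610ad7; leaf V3 «Prop 7 from a background (14)») — sub-lemma V3-C (linear core), part 2/3: A-PRIORI ESTIMATES FOR THE TRIDIAGONAL NORMAL
# OPERATOR OF THE STRAIGHT-LINE BLOCK AVERAGE (sup, `ℓ¹`, `ℓ²`) AND ITS `k`-UNIFORM DIAGONAL DOMINANCE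

Cell `ym3-torus` ∕ fleet seat `ym-ust-19200-p1` (gen 3).  Second file of the right-inverse series (part 1: `UnitScaleTiltProp7LineAvgTwoBlock` — the
normal operator `M_kM_k^†` of the straight-line `k`-fold block average is `D·(α·I + γ·(S_μ + S_μ⁻¹))` on coarse bond fields, `S_μ` the unit
translation along the bond's own axis, `α`, `γ` the tent moments).  Here: the three a-priori estimates for ANY operator of that shape with `α > 2γ`
(valid on every coarse torus, including the wrap-around sizes 1 and 2 where `S_μ = S_μ⁻¹` or `S_μ = 1`, since only re-indexing of sums is used), and
the computation `α − 2γ = Σ_{s<n}(2s+2−n)² = (n³+2n)/3` giving the `k`-UNIFORM dominance ratio `2γ/α < 1/2` and the key constant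
`3L^{kd}·D(α − 2γ) = 1 + 2L^{−2k} ≥ 1` for `D = (L^{kd}L^k)⁻²(L^k)^{d−1}` ([Balaban1985Variational] (46): «|HB| ≤ B₀(L^jη)⁻¹|B|» with `B₀`
independent of `k` — here `B₀ = 3` for the tent right inverse, part 3).

WHAT IS PROVED HERE (sorry-free, no definition; [folklore] finite-dimensional linear algebra).
* §4 for `D, γ ≥ 0`, `K ≥ 0`, `K·D(α−2γ) ≥ 1` and `D(αW(c) + γW(c−e_μ) + γW(c+e_μ)) = Z(c)` on the bonds of any torus `T^{(j)}`:
  `tridiag_sup_le` (`max|W| ≤ K·max|Z|`), `tridiag_l1_le` (`Σ|W| ≤ KΣ|Z|`), `tridiag_l2_le` (`ΣW² ≤ K²ΣZ²`, from `⟨W, TW⟩ ≥ D(α−2γ)‖W‖²` and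
  Cauchy–Schwarz); re-indexing lemmas `sum_pbond_unshift`, `sum_pbond_runSite_one`.
* §5 `three_mul_sum_sq_tent` (`3Σ_{s<n}(2s+2−n)² = n³+2n`), `tent_moments_sub` (`α − 2γ = (n³+2n)/3`), `tent_gamma_nonneg`, and
  **`key_dominance`**: `1 ≤ 3(L^k)^d · D(α − 2γ)`.

References: T. Bałaban, CMP 102 (1985) 277–309 [Balaban1985Variational] ((45)–(46) p.285).
-/

noncomputable section

open scoped BigOperators

namespace Summit.QuantumFields.YangMills.Theorems.Prop7LineAvgRightInverse

open Literature.MathematicalPhysics.QuantumFieldTheory.Balaban1983to89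
open Finset LatticeFieldCalculus B1RG242Torus
open B10StarCount (sum_pbond)
open Summit.QuantumFields.YangMills.Theorems.Prop7FlatCoercivity (iterate_shift_eq_runSite runSite_runSite runSite_apply_self
  runSite_apply_of_ne fibreSite_runSite sum_fibre_eq_sum_offsets)

variable {P : Params} {k : ℕ}

/-! ## §4 A-priori estimates for an axis-tridiagonal, diagonally dominant operator on coarse bond fields -/

section Tridiagonal

/-- One unit step forward is the unit shift. [folklore] -/
theorem runSite_one {j : ℕ} (x : Site P j) (μ : Fin P.d) : runSite x μ 1 = x.shift μ := by
  rw [show (1 : ℕ) = 0 + 1 from rfl, runSite_succ, runSite_zero]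

/-- Re-indexing a bond sum by the backward unit translation of the initial point along the bond's own direction. [folklore] -/
theorem sum_pbond_unshift {j : ℕ} (F : PBond P j → ℝ) : ∑ c : PBond P j, F ⟨c.src.unshift c.dir, c.dir⟩ = ∑ c : PBond P j, F c := by
  rw [sum_pbond (fun c : PBond P j => F ⟨c.src.unshift c.dir, c.dir⟩), sum_pbond F, Finset.sum_comm]
  conv_rhs => rw [Finset.sum_comm]
  refine Finset.sum_congr rfl fun μ _ => ?_
  exact Equiv.sum_comp (B10StarCount.shiftEquiv μ).symm (fun x => F ⟨x, μ⟩)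

/-- Re-indexing a bond sum by the forward unit translation of the initial point along the bond's own direction. [folklore] -/
theorem sum_pbond_runSite_one {j : ℕ} (F : PBond P j → ℝ) : ∑ c : PBond P j, F ⟨runSite c.src c.dir 1, c.dir⟩ = ∑ c : PBond P j, F c := by
  simp only [runSite_one]
  rw [sum_pbond (fun c : PBond P j => F ⟨c.src.shift c.dir, c.dir⟩), sum_pbond F, Finset.sum_comm]
  conv_rhs => rw [Finset.sum_comm]
  refine Finset.sum_congr rfl fun μ _ => ?_
  exact Equiv.sum_comp (B10StarCount.shiftEquiv μ) (fun x => F ⟨x, μ⟩)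

variable {j : ℕ} (D α γ : ℝ) (W Z : PBond P j → ℝ) (hD : 0 ≤ D) (hγ : 0 ≤ γ)
  (hT : ∀ c : PBond P j, D * (α * W c + γ * W ⟨c.src.unshift c.dir, c.dir⟩ + γ * W ⟨runSite c.src c.dir 1, c.dir⟩) = Z c)
include hD hγ hT

/-- Pointwise consequence of the tridiagonal equation: `Dα|W(c)| ≤ |Z(c)| + Dγ(|W(c − e_μ)| + |W(c + e_μ)|)`. [folklore] -/
theorem tridiag_pointwise (c : PBond P j) :
    D * α * |W c| ≤ |Z c| + D * γ * (|W ⟨c.src.unshift c.dir, c.dir⟩| + |W ⟨runSite c.src c.dir 1, c.dir⟩|) := by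
  have h1 : D * α * W c = Z c - D * γ * (W ⟨c.src.unshift c.dir, c.dir⟩ + W ⟨runSite c.src c.dir 1, c.dir⟩) := by
    linear_combination hT c
  have h2 : |D * α * W c| ≤ |Z c| + |D * γ * (W ⟨c.src.unshift c.dir, c.dir⟩ + W ⟨runSite c.src c.dir 1, c.dir⟩)| := by
    rw [h1]; exact abs_sub _ _
  rw [abs_mul, abs_mul, abs_of_nonneg hD, abs_mul, abs_mul, abs_of_nonneg hD, abs_of_nonneg hγ] at h2
  have h3 := abs_add_le (W ⟨c.src.unshift c.dir, c.dir⟩) (W ⟨runSite c.src c.dir 1, c.dir⟩)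
  have h4 : |α| * |W c| ≥ α * |W c| := mul_le_mul_of_nonneg_right (le_abs_self α) (abs_nonneg _)
  nlinarith [mul_nonneg hD hγ, h2, h3, h4]

variable (K : ℝ) (hK : 0 ≤ K) (key : 1 ≤ K * (D * (α - 2 * γ)))
include hK key

/-- **SUP-NORM A-PRIORI ESTIMATE** (diagonal dominance `α > 2γ`): `‖W‖_∞ ≤ K‖Z‖_∞` whenever `K·D(α − 2γ) ≥ 1`. [folklore] -/
theorem tridiag_sup_le {B : ℝ} (hZ : ∀ c : PBond P j, |Z c| ≤ B) : ∀ c : PBond P j, |W c| ≤ K * B := by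
  have hne : (univ : Finset (PBond P j)).Nonempty := ⟨⟨fun _ => 0, ⟨0, P.hd⟩⟩, mem_univ _⟩
  obtain ⟨c₀, -, hmax⟩ := Finset.exists_max_image univ (fun c : PBond P j => |W c|) hne
  have hB : 0 ≤ B := (abs_nonneg _).trans (hZ c₀)
  have h1 := tridiag_pointwise D α γ W Z hD hγ hT c₀
  have h2 : |W ⟨c₀.src.unshift c₀.dir, c₀.dir⟩| ≤ |W c₀| := hmax _ (mem_univ _)
  have h3 : |W ⟨runSite c₀.src c₀.dir 1, c₀.dir⟩| ≤ |W c₀| := hmax _ (mem_univ _)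
  have h4 : D * (α - 2 * γ) * |W c₀| ≤ B := by nlinarith [mul_nonneg hD hγ, hZ c₀]
  have h5 : |W c₀| ≤ K * B := by
    have : |W c₀| ≤ (K * (D * (α - 2 * γ))) * |W c₀| := by nlinarith [abs_nonneg (W c₀)]
    nlinarith [this, h4]
  intro c
  exact (hmax c (mem_univ _)).trans h5

/-- **`ℓ¹` A-PRIORI ESTIMATE**: `Σ|W| ≤ K·Σ|Z|` whenever `K·D(α − 2γ) ≥ 1`. [folklore] -/
theorem tridiag_l1_le : ∑ c : PBond P j, |W c| ≤ K * ∑ c : PBond P j, |Z c| := by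
  have h1 : ∑ c : PBond P j, D * α * |W c|
      ≤ ∑ c : PBond P j, (|Z c| + D * γ * (|W ⟨c.src.unshift c.dir, c.dir⟩| + |W ⟨runSite c.src c.dir 1, c.dir⟩|)) :=
    Finset.sum_le_sum fun c _ => tridiag_pointwise D α γ W Z hD hγ hT c
  rw [Finset.sum_add_distrib] at h1
  simp only [mul_add, Finset.sum_add_distrib, ← Finset.mul_sum] at h1
  rw [sum_pbond_unshift (fun c => |W c|), sum_pbond_runSite_one (fun c => |W c|)] at h1
  have h2 : D * (α - 2 * γ) * ∑ c : PBond P j, |W c| ≤ ∑ c : PBond P j, |Z c| := by nlinarith [h1]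
  have h3 : 0 ≤ ∑ c : PBond P j, |W c| := Finset.sum_nonneg fun c _ => abs_nonneg _
  have : ∑ c : PBond P j, |W c| ≤ (K * (D * (α - 2 * γ))) * ∑ c : PBond P j, |W c| := by nlinarith
  nlinarith [this, h2]

/-- **`ℓ²` A-PRIORI ESTIMATE**: `Σ W² ≤ K²·Σ Z²` whenever `K·D(α − 2γ) ≥ 1` (the form `⟨W, TW⟩ ≥ D(α − 2γ)‖W‖²` and Cauchy–Schwarz).
[folklore] -/
theorem tridiag_l2_le : ∑ c : PBond P j, (W c) ^ 2 ≤ K ^ 2 * ∑ c : PBond P j, (Z c) ^ 2 := by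
  -- the quadratic form
  have hform : ∑ c : PBond P j, W c * Z c = D * (α * ∑ c : PBond P j, (W c) ^ 2
      + γ * ∑ c : PBond P j, W c * W ⟨c.src.unshift c.dir, c.dir⟩ + γ * ∑ c : PBond P j, W c * W ⟨runSite c.src c.dir 1, c.dir⟩) := by
    simp only [← hT, Finset.mul_sum, ← Finset.sum_add_distrib]
    exact Finset.sum_congr rfl fun c _ => by ring
  have hm : ∑ c : PBond P j, W c * W ⟨c.src.unshift c.dir, c.dir⟩ ≥ - ∑ c : PBond P j, (W c) ^ 2 := by
    have h0 : 0 ≤ ∑ c : PBond P j, (W c + W ⟨c.src.unshift c.dir, c.dir⟩) ^ 2 := Finset.sum_nonneg fun c _ => sq_nonneg _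
    have e : ∑ c : PBond P j, (W c + W ⟨c.src.unshift c.dir, c.dir⟩) ^ 2 = ∑ c : PBond P j, (W c) ^ 2
        + 2 * ∑ c : PBond P j, W c * W ⟨c.src.unshift c.dir, c.dir⟩ + ∑ c : PBond P j, (W ⟨c.src.unshift c.dir, c.dir⟩) ^ 2 := by
      simp only [Finset.mul_sum, ← Finset.sum_add_distrib]; exact Finset.sum_congr rfl fun c _ => by ring
    rw [e, sum_pbond_unshift (fun c => (W c) ^ 2)] at h0
    linarith
  have hp : ∑ c : PBond P j, W c * W ⟨runSite c.src c.dir 1, c.dir⟩ ≥ - ∑ c : PBond P j, (W c) ^ 2 := by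
    have h0 : 0 ≤ ∑ c : PBond P j, (W c + W ⟨runSite c.src c.dir 1, c.dir⟩) ^ 2 := Finset.sum_nonneg fun c _ => sq_nonneg _
    have e : ∑ c : PBond P j, (W c + W ⟨runSite c.src c.dir 1, c.dir⟩) ^ 2 = ∑ c : PBond P j, (W c) ^ 2
        + 2 * ∑ c : PBond P j, W c * W ⟨runSite c.src c.dir 1, c.dir⟩ + ∑ c : PBond P j, (W ⟨runSite c.src c.dir 1, c.dir⟩) ^ 2 := by
      simp only [Finset.mul_sum, ← Finset.sum_add_distrib]; exact Finset.sum_congr rfl fun c _ => by ring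
    rw [e, sum_pbond_runSite_one (fun c => (W c) ^ 2)] at h0
    linarith
  set S := ∑ c : PBond P j, (W c) ^ 2 with hS
  set Q := ∑ c : PBond P j, (Z c) ^ 2 with hQ
  have hS0 : 0 ≤ S := Finset.sum_nonneg fun c _ => sq_nonneg _
  have hQ0 : 0 ≤ Q := Finset.sum_nonneg fun c _ => sq_nonneg _
  have hlow : D * (α - 2 * γ) * S ≤ ∑ c : PBond P j, W c * Z c := by
    rw [hform]; nlinarith [mul_nonneg hD hγ]
  have hCS : (∑ c : PBond P j, W c * Z c) ^ 2 ≤ S * Q := Finset.sum_mul_sq_le_sq_mul_sq univ W Z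
  have hm0 : 0 ≤ D * (α - 2 * γ) := by nlinarith
  have h1 : (D * (α - 2 * γ) * S) ^ 2 ≤ S * Q := le_trans (pow_le_pow_left₀ (by positivity) hlow 2) hCS
  rcases hS0.eq_or_lt with hS00 | hSpos
  · rw [← hS00]; positivity
  · have h2 : (D * (α - 2 * γ)) ^ 2 * S ≤ Q := by
      have : (D * (α - 2 * γ)) ^ 2 * S * S ≤ Q * S := by nlinarith [h1]
      exact le_of_mul_le_mul_right this hSpos
    calc S = 1 * S := (one_mul S).symm
      _ ≤ (K * (D * (α - 2 * γ))) ^ 2 * S := by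
          apply mul_le_mul_of_nonneg_right _ hS0
          nlinarith [key]
      _ = K ^ 2 * ((D * (α - 2 * γ)) ^ 2 * S) := by ring
      _ ≤ K ^ 2 * Q := mul_le_mul_of_nonneg_left h2 (sq_nonneg K)

end Tridiagonal

/-! ## §5 The tent moments and the key diagonal-dominance constant -/

section Moments

/-- The second moment of the centred tent: `3·Σ_{s<n} (2s + 2 − n)² = n³ + 2n`. [folklore] -/
theorem three_mul_sum_sq_tent (n : ℕ) : 3 * ∑ s ∈ range n, (2 * (s : ℝ) + 2 - n) ^ 2 = (n : ℝ) ^ 3 + 2 * n := by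
  -- the two Gauss sums, inlined (tree lemmas of the same shape live in unrelated modules)
  have S1 : ∀ m : ℕ, ∑ s ∈ range m, ((s : ℝ) + 1) = (m : ℝ) * (m + 1) / 2 := by
    intro m
    induction m with
    | zero => simp
    | succ m ih => rw [Finset.sum_range_succ, ih]; push_cast; ring
  have S2 : ∀ m : ℕ, ∑ s ∈ range m, ((s : ℝ) + 1) ^ 2 = (m : ℝ) * (m + 1) * (2 * m + 1) / 6 := by
    intro m
    induction m with
    | zero => simp
    | succ m ih => rw [Finset.sum_range_succ, ih]; push_cast; ring
  have e : ∀ s ∈ range n, (2 * (s : ℝ) + 2 - n) ^ 2 = 4 * ((s : ℝ) + 1) ^ 2 - 4 * (n : ℝ) * ((s : ℝ) + 1) + (n : ℝ) ^ 2 :=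
    fun s _ => by ring
  rw [Finset.sum_congr rfl e, Finset.sum_add_distrib, Finset.sum_sub_distrib, ← Finset.mul_sum, ← Finset.mul_sum, S1, S2]
  simp only [Finset.sum_const, Finset.card_range, nsmul_eq_mul]
  ring

/-- The descending tent weight as a real number: `(n − 1 − s : ℕ) = n − 1 − s` for `s < n`. [folklore] -/
theorem cast_tent (n : ℕ) (s : Fin n) : ((n - 1 - (s : ℕ) : ℕ) : ℝ) = (n : ℝ) - 1 - (s : ℕ) := by
  have hs := s.isLt
  rw [Nat.sub_sub, Nat.cast_sub (by omega)]
  push_cast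
  ring

/-- **DIAGONAL DOMINANCE OF THE NORMAL OPERATOR**: `α − 2γ = Σ_{s<n}(2s+2−n)² = (n³ + 2n)/3` for the tent moments
`α = Σ((s+1)² + (n−1−s)²)`, `γ = Σ(s+1)(n−1−s)`. [folklore] -/
theorem tent_moments_sub (n : ℕ) :
    (∑ s : Fin n, ((((s : ℕ) : ℝ) + 1) ^ 2 + (((n - 1 - (s : ℕ) : ℕ) : ℝ)) ^ 2))
        - 2 * ∑ s : Fin n, (((s : ℕ) : ℝ) + 1) * ((n - 1 - (s : ℕ) : ℕ) : ℝ)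
      = ((n : ℝ) ^ 3 + 2 * n) / 3 := by
  have e : ∀ s : Fin n, ((((s : ℕ) : ℝ) + 1) ^ 2 + (((n - 1 - (s : ℕ) : ℕ) : ℝ)) ^ 2)
      - 2 * ((((s : ℕ) : ℝ) + 1) * ((n - 1 - (s : ℕ) : ℕ) : ℝ)) = (2 * ((s : ℕ) : ℝ) + 2 - n) ^ 2 := by
    intro s; rw [cast_tent]; ring
  rw [Finset.mul_sum, ← Finset.sum_sub_distrib, Finset.sum_congr rfl (fun s _ => e s)]
  have t := three_mul_sum_sq_tent n
  simp only [Finset.sum_range] at t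
  linarith

/-- The off-diagonal tent moment is non-negative. [folklore] -/
theorem tent_gamma_nonneg (n : ℕ) : 0 ≤ ∑ s : Fin n, (((s : ℕ) : ℝ) + 1) * ((n - 1 - (s : ℕ) : ℕ) : ℝ) :=
  Finset.sum_nonneg fun s _ => by positivity

variable (P k)

/-- **THE KEY CONSTANT**: with `N = L^k`, `3N^d · [(N^dN)⁻¹·N^{d−1}·(N^dN)⁻¹·(α − 2γ)] = 1 + 2N⁻² ≥ 1` — the normal operator of the
straight-line average is diagonally dominant with ratio `2γ/α < 1/2`, uniformly in `k` and in the volume. [folklore] -/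
theorem key_dominance :
    1 ≤ 3 * ((P.L : ℝ) ^ k) ^ P.d * ((((P.L : ℝ) ^ k) ^ P.d * (P.L : ℝ) ^ k)⁻¹ * ((((P.L ^ k : ℕ) : ℝ) ^ (P.d - 1)) *
      (((P.L : ℝ) ^ k) ^ P.d * (P.L : ℝ) ^ k)⁻¹) *
      ((∑ s : Fin (P.L ^ k), ((((s : ℕ) : ℝ) + 1) ^ 2 + (((P.L ^ k - 1 - (s : ℕ) : ℕ) : ℝ)) ^ 2))
        - 2 * ∑ s : Fin (P.L ^ k), (((s : ℕ) : ℝ) + 1) * ((P.L ^ k - 1 - (s : ℕ) : ℕ) : ℝ))) := by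
  rw [tent_moments_sub]
  have hN : (0 : ℝ) < (P.L : ℝ) ^ k := pow_pos (by exact_mod_cast P.L_pos) k
  have hcast : ((P.L ^ k : ℕ) : ℝ) = (P.L : ℝ) ^ k := by push_cast; ring
  rw [hcast]
  set N : ℝ := (P.L : ℝ) ^ k with hNdef
  have hA : (0 : ℝ) < N ^ (P.d - 1) := pow_pos hN _
  have hNd : N ^ (P.d - 1) * N = N ^ P.d := by rw [← pow_succ, Nat.sub_add_cancel P.hd]
  rw [← hNd]
  have e : 3 * (N ^ (P.d - 1) * N) * ((N ^ (P.d - 1) * N * N)⁻¹ * (N ^ (P.d - 1) * (N ^ (P.d - 1) * N * N)⁻¹) *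
      ((N ^ 3 + 2 * N) / 3)) = 1 + 2 / N ^ 2 := by
    field_simp
  rw [e]
  have : 0 ≤ 2 / N ^ 2 := by positivity
  linarith

end Moments

end Summit.QuantumFields.YangMills.Theorems.Prop7LineAvgRightInverse

end
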